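import Summits.AnomalousDissipation.AnomalousDissipation.Theorems.SolenoidalFractalHomogenisationLagrangianStepVmodFrameDefsJE
import Summits.AnomalousDissipation.AnomalousDissipation.Theorems.SolenoidalFractalHomogenisationLagrangianStepCellEnergyTDualDefs
import HarnessLib

/-!
# K1L_D (stmt-AnomalousDissipation-27980), (ℓ3-A) road A glue (L24 (O3)+(O4)): the PAIR clause `EnergyDuhamelG` — energy identities of BOTH
# members and the weak × weak DUHAMEL cross identity on SHARED witnesses (bytes of the local binder `hED`; tenure RULING D28-25 (1))
(Summits-side definitions file of route `SolenoidalFractalHomogenisation`; review lane; typist ad-lit g33 per D28-25 (1); `--supports 27980`.)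

CONVENTION (D28-8′): derivative-index distortion `Torus.Visc4.conj`; constraint `∇·(G v) = 0`; class variable `v = u ∘ X`.

WHAT.  For the two distorted propagators of a J-cut block — the CELL member `U` (carrier `bU`, tensor `𝔸U`, frame `G`) and the COARSE member
`T` (drift-free in the frame: carrier `fun _ _ => 0`, tensor `𝔸T`, same frame `G`) — `VmodDist.EnergyDuhamelG Tw 𝔸U 𝔸T bU G U T` says: for
every window end `0 < t₀ ≤ Tw` and every `G(t₀)`-solenoidal test datum `φ ∈ V2` there are an ADJOINT WITNESS `(Ψ, DΨ)` of the coarse member —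
a distorted weak solution of the backward problem (tensor `majorTranspose 𝔸T`, carrier `revCarrier (fun _ _ => 0) t₀`, frame `σ ↦ G (t₀ − σ)`;
reversed clock `σ = t₀ − r`) from `φ` with its weak gradient, PINNED a.e. to the adjoint propagator (`toLp (Ψ σ) = (T (t₀−σ) t₀)† φ`, the
`IsDistortedPropagator.repr` idiom), satisfying the ADJOINT ENERGY identity of `T` (the matrix of `EnergyIdGAdj` VERBATIM) — and, for every base
time `s ∈ [0, t₀)` and every `G(s)`-solenoidal datum `x ∈ V2`, a FORWARD WITNESS `(w, Dw)` of the cell member from `(s, x)` (class, `L²` weak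
gradient, a.e. weak partial derivatives — `EnergyIdG`'s three clauses VERBATIM) satisfying the FORWARD ENERGY identity of `U` (`EnergyIdG`'s last
clause VERBATIM) AND, on the SAME two witnesses, the weak × weak DUHAMEL CROSS IDENTITY on `[s, t₀]`

  `⟪U s t₀ x, φ⟫ − ⟪T s t₀ x, φ⟫ = ∫_{τ ∈ (0, t₀−s]} ( Σⱼ ∫ ⟪(bU (s+τ) y)ⱼ • w τ y, DΨ (t₀−s−τ) j y⟫ dy`
  `                                   − ∫ Σ_{l,i,c,e} (𝔸U − 𝔸T)^{G(s+τ,y)}_{icle} (DΨ (t₀−s−τ) c y)_i (Dw τ e y)_l dy ) dτ`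

(TRANSPORT cross term: the cell drift on the forward state against the weak gradient of the adjoint state; VISCOUS cross term: the conjugated
tensor DIFFERENCE between the two weak gradients, TEST gradient in the `(c,i)` slots and SOLUTION gradient in the `(e,l)` slots — the orientation of
`Torus.integral_inner_viscAdjVar_eq_neg_integral_sum` / `viscAdjVar`, which matters because `OddSmall` tensors are not major-symmetric), with both
cross summands integrable in `τ`.  Witness sharing is forced (the abstract class has no uniqueness theorem): the Cauchy–Schwarz step of the glue
consumes the cross identity and BOTH energy identities on the same `(w, Dw)`, `(Ψ, DΨ)` (lead memo L24 §1 (O3)–(O5)).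

WHY THIS SHAPE (ad-lit g33 triage L33-1, STATUS 15:11:43Z; ruled D28-25 (1)): the «adjoint-coarse test regularity» (O4) — `Ψ` an admissible
time-Lipschitz test — is XL abstractly (moving-constraint parabolic smoothing) and L at the instance ((O4-flat), not commissioned); the Duhamel
identity itself holds WEAK × WEAK and is discharged at the instance with ZERO new Literature: flat Z1′
`Torus.IsWeakTensorPassiveVectorOn.twoProblemDuality_traces` (Fourier cross terms) read in the frame by Z6-T `…FrameTransport.tsum_transport_frame` /
`hasSum_transport_fourier`, Z6-E `…FrameEddy.tsum_eddy_frame` / `hasSum_eddy_fourier`, `Torus.integral_viscPairing_comp_add_proj(_distort)`, members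
identified by `isDistortedPropagator_conjProp_clamped` + `adjoint_frameRead_apply` + `repr` — the chain of `…WindowDualityE.inner_sub_eq_setIntegral_cross_level_eddy`
(p680494); energies by the (E1-T) instance road (`IsPropagator.exists_norm_sq_eq`, `Torus.adjoint_propagator`).

DEGENERATE READING `G ≡ 1` (certifier probe): `(𝔸U − 𝔸T)^{1} = 𝔸U − 𝔸T` (`energyDuhamelG_one_crossTensor`), `revCarrier (fun _ _ => 0) t₀ = fun _ _ => 0`
(`revCarrier_zero`), and the cross identity is the PHYSICAL form of flat Z1′ with `b₁ − b₂ = bU`, `𝔸₁ − 𝔸₂ = 𝔸U − 𝔸T`: transport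
`Σ'ₖ Σⱼ 2πikⱼ ⟪𝓕((bU)ⱼ u)(k), ψ̂(k)⟫ = Σⱼ ∫⟪(bU)ⱼ u, ∂ⱼψ⟫` (`hasSum_transport_fourier`) and eddy `Σ'ₖ −4π²⟪û(k), T_{𝔸U−𝔸T}(k) ψ̂(k)⟫ =
−∫ Σ (𝔸U−𝔸T) i a j b (∂_a ·)(∂_b ·)` (`hasSum_eddy_fourier`; for a constant tensor the two derivative slots may be exchanged by parts, the component slots
may not: test ↔ first index, solution ↔ third index, as in `symbT`).

* `EnergyDuhamelG`; `energyDuhamelG_iff` (unfolding);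
* the single-member projections it literally admits: `EnergyDuhamelG.energyIdGAdj : … → EnergyIdGAdj Tw 𝔸T (fun _ _ => 0) G T` (drop the pin, the
  integrability and the forward block) and `EnergyDuhamelG.energyIdG : … → EnergyIdG Tw 𝔸U bU G U` (instantiate `t₀ := Tw`, `φ := 0`);
* `EnergyDuhamelG.duhamel` (the cross identity with its witnesses, consumer form), `revCarrier_zero`, `energyDuhamelG_one_crossTensor`,
  `isWeaklyDivFree_distort_coe_zero` (`φ := 0` is admissible at every frame).
CONSUMERS take `hED : VmodDist.EnergyDuhamelG Tw 𝔸U 𝔸T bU G U T` as ONE explicit lemma hypothesis (the `hsol`/`hEnergy` precedent, D28-21′); fold =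
amendment «v3B» later (D28-25 (1)).  Definitions + trivial lemmas only; NOT a proof of any block, of K1L_D or of AD; rung F-D1.A0.
-/

set_option linter.dupNamespace false

noncomputable section

namespace Summit.AnomalousDissipation.AnomalousDissipation.Theorems.SolenoidalFractalHomogenisation.LagrangianStep.VmodDist

open Literature.Analysis Literature.Analysis.FluidPDE Literature.Analysis.FunctionSpaces
open MeasureTheory Set Filter UnitAddTorus Function
open scoped ENNReal NNReal InnerProductSpace
open Summit.AnomalousDissipation.AnomalousDissipation.Theorems.SolenoidalFractalHomogenisation.LagrangianStep.CellClauseMod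
open Summit.AnomalousDissipation.AnomalousDissipation.Theorems.SolenoidalFractalHomogenisation.LagrangianStep.CellEnergyT

/-- **`EnergyDuhamelG Tw 𝔸U 𝔸T bU G U T` — the PAIR clause of the J-cut glue: adjoint energy identity of the coarse member `T`, forward energy
identity of the cell member `U`, and the weak × weak Duhamel cross identity, on SHARED witnesses** (bytes of the local binder `hED`, RULING D28-25 (1);
see the module docstring for the reading of every clause).  [cite: LionsMagenes1972, Chap. 3 §4.4 (4.20)] [cite: Temam1984, Ch. III §1 Lemma 1.2, Thm. 1.1]
[cite: DiPernaLions1989, §II.1 (12)–(14)] -/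
def EnergyDuhamelG (Tw : ℝ) (𝔸U 𝔸T : Torus.Visc4 (Fin 3)) (bU : ℝ → VF) (G : ℝ → UnitAddTorus (Fin 3) → Matrix (Fin 3) (Fin 3) ℝ)
    (U T : ℝ → ℝ → (V2 →L[ℝ] V2)) : Prop :=
  ∀ t₀ : ℝ, 0 < t₀ → t₀ ≤ Tw → ∀ φ : V2, Torus.IsWeaklyDivFree (Torus.distort (G t₀) ((φ : V2) : VF)) →
    ∃ (Ψ : ℝ → VF) (DΨ : ℝ → Fin 3 → VF),
      -- (pin) `Ψ` represents the adjoint orbit of the coarse member, reversed clock `σ = t₀ − r` (the `repr` idiom)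
      (∀ᵐ σ ∂(volume.restrict (Ioo 0 t₀)), ∃ hσ : MemLp (Ψ σ) 2 volume,
        hσ.toLp (Ψ σ) = ContinuousLinearMap.adjoint (T (t₀ - σ) t₀) φ) ∧
      -- (adjoint witness: class, weak gradient, a.e. weak partial derivatives — `EnergyIdGAdj`'s clauses for the drift-free member)
      Torus.IsWeakTensorPassiveVectorDistortedOn 0 t₀ (Torus.majorTranspose 𝔸T) (revCarrier (fun _ _ => 0) t₀) (fun σ => G (t₀ - σ))
        ((φ : V2) : VF) Ψ ∧
      (∀ c, MemLp (uncurry (DΨ · c)) 2 (((volume : Measure ℝ).restrict (Ioo 0 t₀)).prod volume)) ∧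
      (∀ᵐ σ ∂(volume.restrict (Ioo 0 t₀)), ∀ c, Torus.HasWeakPartialDeriv c (Ψ σ) (DΨ σ c)) ∧
      -- (adjoint energy identity of `T`: the matrix of `EnergyIdGAdj` VERBATIM)
      (∀ s ∈ Ico 0 t₀, ‖ContinuousLinearMap.adjoint (T s t₀) φ‖ ^ 2 = ‖φ‖ ^ 2 -
        2 * ∫ σ in Ioc 0 (t₀ - s), ∫ x, ∑ l, ∑ i, ∑ c, ∑ e,
          Torus.Visc4.conj (G (t₀ - σ) x) (Torus.majorTranspose 𝔸T) i c l e * (DΨ σ c x) i * (DΨ σ e x) l) ∧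
      -- (forward block, every base time `s ∈ [0, t₀)`)
      ∀ s ∈ Ico 0 t₀, ∀ x : V2, Torus.IsWeaklyDivFree (Torus.distort (G s) ((x : V2) : VF)) →
        ∃ (w : ℝ → VF) (Dw : ℝ → Fin 3 → VF),
          -- (forward witness: `EnergyIdG`'s three clauses VERBATIM at base `s`)
          Torus.IsWeakTensorPassiveVectorDistortedOn 0 (Tw - s) 𝔸U (fun τ => bU (s + τ)) (fun τ => G (s + τ)) ((x : V2) : VF) w ∧
          (∀ c, MemLp (uncurry (Dw · c)) 2 (((volume : Measure ℝ).restrict (Ioo 0 (Tw - s))).prod volume)) ∧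
          (∀ᵐ τ ∂(volume.restrict (Ioo 0 (Tw - s))), ∀ c, Torus.HasWeakPartialDeriv c (w τ) (Dw τ c)) ∧
          -- (forward energy identity of `U`: `EnergyIdG`'s last clause VERBATIM)
          (∀ t ∈ Ico s Tw, ‖U s t x‖ ^ 2 = ‖x‖ ^ 2 -
            2 * ∫ τ in Ioc 0 (t - s), ∫ y, ∑ l, ∑ i, ∑ c, ∑ e,
              Torus.Visc4.conj (G (s + τ) y) 𝔸U i c l e * (Dw τ c y) i * (Dw τ e y) l) ∧
          -- (integrability of the two cross summands on the window `(0, t₀ − s]`)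
          IntegrableOn (fun τ => ∑ j, ∫ y, ⟪(bU (s + τ) y) j • w τ y, DΨ (t₀ - s - τ) j y⟫_ℝ) (Ioc 0 (t₀ - s)) volume ∧
          IntegrableOn (fun τ => ∫ y, ∑ l, ∑ i, ∑ c, ∑ e,
            Torus.Visc4.conj (G (s + τ) y) (𝔸U - 𝔸T) i c l e * (DΨ (t₀ - s - τ) c y) i * (Dw τ e y) l) (Ioc 0 (t₀ - s)) volume ∧
          -- (THE DUHAMEL CROSS IDENTITY on `[s, t₀]`, weak × weak, shared witnesses)
          ⟪U s t₀ x, φ⟫_ℝ - ⟪T s t₀ x, φ⟫_ℝ =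
            ∫ τ in Ioc 0 (t₀ - s),
              ((∑ j, ∫ y, ⟪(bU (s + τ) y) j • w τ y, DΨ (t₀ - s - τ) j y⟫_ℝ) -
                ∫ y, ∑ l, ∑ i, ∑ c, ∑ e,
                  Torus.Visc4.conj (G (s + τ) y) (𝔸U - 𝔸T) i c l e * (DΨ (t₀ - s - τ) c y) i * (Dw τ e y) l)

/-- Unfolding. -/
theorem energyDuhamelG_iff {Tw : ℝ} {𝔸U 𝔸T : Torus.Visc4 (Fin 3)} {bU : ℝ → VF} {G : ℝ → UnitAddTorus (Fin 3) → Matrix (Fin 3) (Fin 3) ℝ}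
    {U T : ℝ → ℝ → (V2 →L[ℝ] V2)} :
    EnergyDuhamelG Tw 𝔸U 𝔸T bU G U T ↔
      ∀ t₀ : ℝ, 0 < t₀ → t₀ ≤ Tw → ∀ φ : V2, Torus.IsWeaklyDivFree (Torus.distort (G t₀) ((φ : V2) : VF)) →
        ∃ (Ψ : ℝ → VF) (DΨ : ℝ → Fin 3 → VF),
          (∀ᵐ σ ∂(volume.restrict (Ioo 0 t₀)), ∃ hσ : MemLp (Ψ σ) 2 volume,
            hσ.toLp (Ψ σ) = ContinuousLinearMap.adjoint (T (t₀ - σ) t₀) φ) ∧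
          Torus.IsWeakTensorPassiveVectorDistortedOn 0 t₀ (Torus.majorTranspose 𝔸T) (revCarrier (fun _ _ => 0) t₀) (fun σ => G (t₀ - σ))
            ((φ : V2) : VF) Ψ ∧
          (∀ c, MemLp (uncurry (DΨ · c)) 2 (((volume : Measure ℝ).restrict (Ioo 0 t₀)).prod volume)) ∧
          (∀ᵐ σ ∂(volume.restrict (Ioo 0 t₀)), ∀ c, Torus.HasWeakPartialDeriv c (Ψ σ) (DΨ σ c)) ∧
          (∀ s ∈ Ico 0 t₀, ‖ContinuousLinearMap.adjoint (T s t₀) φ‖ ^ 2 = ‖φ‖ ^ 2 -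
            2 * ∫ σ in Ioc 0 (t₀ - s), ∫ x, ∑ l, ∑ i, ∑ c, ∑ e,
              Torus.Visc4.conj (G (t₀ - σ) x) (Torus.majorTranspose 𝔸T) i c l e * (DΨ σ c x) i * (DΨ σ e x) l) ∧
          ∀ s ∈ Ico 0 t₀, ∀ x : V2, Torus.IsWeaklyDivFree (Torus.distort (G s) ((x : V2) : VF)) →
            ∃ (w : ℝ → VF) (Dw : ℝ → Fin 3 → VF),
              Torus.IsWeakTensorPassiveVectorDistortedOn 0 (Tw - s) 𝔸U (fun τ => bU (s + τ)) (fun τ => G (s + τ)) ((x : V2) : VF) w ∧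
              (∀ c, MemLp (uncurry (Dw · c)) 2 (((volume : Measure ℝ).restrict (Ioo 0 (Tw - s))).prod volume)) ∧
              (∀ᵐ τ ∂(volume.restrict (Ioo 0 (Tw - s))), ∀ c, Torus.HasWeakPartialDeriv c (w τ) (Dw τ c)) ∧
              (∀ t ∈ Ico s Tw, ‖U s t x‖ ^ 2 = ‖x‖ ^ 2 -
                2 * ∫ τ in Ioc 0 (t - s), ∫ y, ∑ l, ∑ i, ∑ c, ∑ e,
                  Torus.Visc4.conj (G (s + τ) y) 𝔸U i c l e * (Dw τ c y) i * (Dw τ e y) l) ∧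
              IntegrableOn (fun τ => ∑ j, ∫ y, ⟪(bU (s + τ) y) j • w τ y, DΨ (t₀ - s - τ) j y⟫_ℝ) (Ioc 0 (t₀ - s)) volume ∧
              IntegrableOn (fun τ => ∫ y, ∑ l, ∑ i, ∑ c, ∑ e,
                Torus.Visc4.conj (G (s + τ) y) (𝔸U - 𝔸T) i c l e * (DΨ (t₀ - s - τ) c y) i * (Dw τ e y) l) (Ioc 0 (t₀ - s)) volume ∧
              ⟪U s t₀ x, φ⟫_ℝ - ⟪T s t₀ x, φ⟫_ℝ =
                ∫ τ in Ioc 0 (t₀ - s),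
                  ((∑ j, ∫ y, ⟪(bU (s + τ) y) j • w τ y, DΨ (t₀ - s - τ) j y⟫_ℝ) -
                    ∫ y, ∑ l, ∑ i, ∑ c, ∑ e,
                      Torus.Visc4.conj (G (s + τ) y) (𝔸U - 𝔸T) i c l e * (DΨ (t₀ - s - τ) c y) i * (Dw τ e y) l) :=
  Iff.rfl

/-! ## Degenerate readings (certifier probes) -/

/-- The reversed carrier of the drift-free member is the zero carrier: `revCarrier (fun _ _ => 0) t₀ = fun _ _ => 0`. -/
theorem revCarrier_zero (t₀ : ℝ) : revCarrier (fun _ _ => (0 : EuclideanSpace ℝ (Fin 3))) t₀ = fun _ _ => 0 := by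
  funext r x
  rw [revCarrier_apply, neg_zero]

/-- For the identity frame the cross tensor is the FLAT difference `(𝔸U − 𝔸T)^{1} = 𝔸U − 𝔸T` (so the viscous cross term is the physical form
`−∫ Σ (𝔸U−𝔸T) icle (∂_cψ)_i (∂_e u)_l` of the Z1′ eddy term, `hasSum_eddy_fourier`). -/
theorem energyDuhamelG_one_crossTensor (𝔸U 𝔸T : Torus.Visc4 (Fin 3)) (i c l e : Fin 3) :
    Torus.Visc4.conj (1 : Matrix (Fin 3) (Fin 3) ℝ) (𝔸U - 𝔸T) i c l e = 𝔸U i c l e - 𝔸T i c l e := by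
  rw [Torus.Visc4.conj_one]; rfl

/-- The zero class `0 : V2` is `G`-solenoidal for EVERY matrix field (its representative is a.e. zero): `φ := 0` is an admissible test datum. -/
theorem isWeaklyDivFree_distort_coe_zero (Gs : UnitAddTorus (Fin 3) → Matrix (Fin 3) (Fin 3) ℝ) :
    Torus.IsWeaklyDivFree (Torus.distort Gs (((0 : V2) : V2) : VF)) := by
  intro θ _
  have h0 : (((0 : V2) : V2) : VF) =ᵐ[volume] 0 := Lp.coeFn_zero _ _ _
  have h1 : (fun y => ⟪Torus.distort Gs (((0 : V2) : V2) : VF) y, Torus.gradient θ y⟫_ℝ) =ᵐ[volume] fun _ => 0 := by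
    filter_upwards [h0] with y hy
    have : Torus.distort Gs (((0 : V2) : V2) : VF) y = 0 := by
      ext c
      rw [Torus.distort_apply, hy]
      simp
    rw [this, inner_zero_left]
  rw [integral_congr_ae h1, integral_zero]

/-! ## The single-member projections -/

/-- **Projection to the coarse member's ADJOINT energy identity**: `EnergyDuhamelG … U T → EnergyIdGAdj Tw 𝔸T (fun _ _ => 0) G T` (literal: drop
the pin, the integrability clauses and the forward block). -/
theorem EnergyDuhamelG.energyIdGAdj {Tw : ℝ} {𝔸U 𝔸T : Torus.Visc4 (Fin 3)} {bU : ℝ → VF}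
    {G : ℝ → UnitAddTorus (Fin 3) → Matrix (Fin 3) (Fin 3) ℝ} {U T : ℝ → ℝ → (V2 →L[ℝ] V2)} (h : EnergyDuhamelG Tw 𝔸U 𝔸T bU G U T) :
    EnergyIdGAdj Tw 𝔸T (fun _ _ => 0) G T := by
  intro t₀ ht₀ ht₀T ζ hζ
  obtain ⟨Ψ, DΨ, _, hcl, hM, hD, hE, _⟩ := h t₀ ht₀ ht₀T ζ hζ
  exact ⟨Ψ, DΨ, hcl, hM, hD, hE⟩

/-- **Projection to the cell member's FORWARD energy identity**: `EnergyDuhamelG … U T → EnergyIdG Tw 𝔸U bU G U` (instantiate the window end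
`t₀ := Tw` and the test datum `φ := 0`, admissible by `isWeaklyDivFree_distort_coe_zero`). -/
theorem EnergyDuhamelG.energyIdG {Tw : ℝ} {𝔸U 𝔸T : Torus.Visc4 (Fin 3)} {bU : ℝ → VF}
    {G : ℝ → UnitAddTorus (Fin 3) → Matrix (Fin 3) (Fin 3) ℝ} {U T : ℝ → ℝ → (V2 →L[ℝ] V2)} (h : EnergyDuhamelG Tw 𝔸U 𝔸T bU G U T) :
    EnergyIdG Tw 𝔸U bU G U := by
  intro s hs hsT y hy
  have hTw : 0 < Tw := lt_of_le_of_lt hs hsT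
  obtain ⟨_, _, _, _, _, _, _, hfwd⟩ := h Tw hTw le_rfl 0 (isWeaklyDivFree_distort_coe_zero (G Tw))
  obtain ⟨w, Dw, hcl, hM, hD, hE, _, _, _⟩ := hfwd s ⟨hs, hsT⟩ y hy
  exact ⟨w, Dw, hcl, hM, hD, hE⟩

/-- **The Duhamel cross identity with its witnesses** (consumer form): for `0 ≤ s < t₀ ≤ Tw`, a `G(t₀)`-solenoidal `φ` and a `G(s)`-solenoidal `x`,
witnesses `(Ψ, DΨ)` (pinned adjoint orbit of `T`, with its class membership and weak gradient) and `(w, Dw)` (forward witness of `U` from `(s,x)`)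
such that `⟪U s t₀ x, φ⟫ − ⟪T s t₀ x, φ⟫ = ∫ (transport cross − viscous cross)`, both summands integrable. -/
theorem EnergyDuhamelG.duhamel {Tw : ℝ} {𝔸U 𝔸T : Torus.Visc4 (Fin 3)} {bU : ℝ → VF}
    {G : ℝ → UnitAddTorus (Fin 3) → Matrix (Fin 3) (Fin 3) ℝ} {U T : ℝ → ℝ → (V2 →L[ℝ] V2)} (h : EnergyDuhamelG Tw 𝔸U 𝔸T bU G U T)
    {s t₀ : ℝ} (hs : 0 ≤ s) (hst : s < t₀) (ht₀T : t₀ ≤ Tw) (φ : V2) (hφ : Torus.IsWeaklyDivFree (Torus.distort (G t₀) ((φ : V2) : VF)))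
    (x : V2) (hx : Torus.IsWeaklyDivFree (Torus.distort (G s) ((x : V2) : VF))) :
    ∃ (Ψ : ℝ → VF) (DΨ : ℝ → Fin 3 → VF) (w : ℝ → VF) (Dw : ℝ → Fin 3 → VF),
      (∀ᵐ σ ∂(volume.restrict (Ioo 0 t₀)), ∃ hσ : MemLp (Ψ σ) 2 volume,
        hσ.toLp (Ψ σ) = ContinuousLinearMap.adjoint (T (t₀ - σ) t₀) φ) ∧
      Torus.IsWeakTensorPassiveVectorDistortedOn 0 t₀ (Torus.majorTranspose 𝔸T) (revCarrier (fun _ _ => 0) t₀) (fun σ => G (t₀ - σ))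
        ((φ : V2) : VF) Ψ ∧
      (∀ᵐ σ ∂(volume.restrict (Ioo 0 t₀)), ∀ c, Torus.HasWeakPartialDeriv c (Ψ σ) (DΨ σ c)) ∧
      Torus.IsWeakTensorPassiveVectorDistortedOn 0 (Tw - s) 𝔸U (fun τ => bU (s + τ)) (fun τ => G (s + τ)) ((x : V2) : VF) w ∧
      (∀ᵐ τ ∂(volume.restrict (Ioo 0 (Tw - s))), ∀ c, Torus.HasWeakPartialDeriv c (w τ) (Dw τ c)) ∧
      IntegrableOn (fun τ => ∑ j, ∫ y, ⟪(bU (s + τ) y) j • w τ y, DΨ (t₀ - s - τ) j y⟫_ℝ) (Ioc 0 (t₀ - s)) volume ∧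
      IntegrableOn (fun τ => ∫ y, ∑ l, ∑ i, ∑ c, ∑ e,
        Torus.Visc4.conj (G (s + τ) y) (𝔸U - 𝔸T) i c l e * (DΨ (t₀ - s - τ) c y) i * (Dw τ e y) l) (Ioc 0 (t₀ - s)) volume ∧
      ⟪U s t₀ x, φ⟫_ℝ - ⟪T s t₀ x, φ⟫_ℝ =
        ∫ τ in Ioc 0 (t₀ - s),
          ((∑ j, ∫ y, ⟪(bU (s + τ) y) j • w τ y, DΨ (t₀ - s - τ) j y⟫_ℝ) -
            ∫ y, ∑ l, ∑ i, ∑ c, ∑ e,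
              Torus.Visc4.conj (G (s + τ) y) (𝔸U - 𝔸T) i c l e * (DΨ (t₀ - s - τ) c y) i * (Dw τ e y) l) := by
  obtain ⟨Ψ, DΨ, hpin, hclA, _, hDA, _, hfwd⟩ := h t₀ (lt_of_le_of_lt hs hst) ht₀T φ hφ
  obtain ⟨w, Dw, hcl, _, hD, _, hI1, hI2, hX⟩ := hfwd s ⟨hs, hst⟩ x hx
  exact ⟨Ψ, DΨ, w, Dw, hpin, hclA, hDA, hcl, hD, hI1, hI2, hX⟩

/-- **The cross identity SPLIT** (what the Cauchy–Schwarz step consumes): with the witnesses of `EnergyDuhamelG.duhamel`,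
`⟪U s t₀ x, φ⟫ − ⟪T s t₀ x, φ⟫ = (∫ transport cross) − (∫ viscous cross)` (integrability of both summands is part of the clause). -/
theorem EnergyDuhamelG.inner_sub_eq_integral_sub_integral {bU : ℝ → VF} {G : ℝ → UnitAddTorus (Fin 3) → Matrix (Fin 3) (Fin 3) ℝ}
    {𝔸U 𝔸T : Torus.Visc4 (Fin 3)} {U T : ℝ → ℝ → (V2 →L[ℝ] V2)} {s t₀ : ℝ} {φ x : V2}
    {w : ℝ → VF} {Dw DΨ : ℝ → Fin 3 → VF}
    (hI1 : IntegrableOn (fun τ => ∑ j, ∫ y, ⟪(bU (s + τ) y) j • w τ y, DΨ (t₀ - s - τ) j y⟫_ℝ) (Ioc 0 (t₀ - s)) volume)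
    (hI2 : IntegrableOn (fun τ => ∫ y, ∑ l, ∑ i, ∑ c, ∑ e,
      Torus.Visc4.conj (G (s + τ) y) (𝔸U - 𝔸T) i c l e * (DΨ (t₀ - s - τ) c y) i * (Dw τ e y) l) (Ioc 0 (t₀ - s)) volume)
    (hX : ⟪U s t₀ x, φ⟫_ℝ - ⟪T s t₀ x, φ⟫_ℝ =
      ∫ τ in Ioc 0 (t₀ - s),
        ((∑ j, ∫ y, ⟪(bU (s + τ) y) j • w τ y, DΨ (t₀ - s - τ) j y⟫_ℝ) -
          ∫ y, ∑ l, ∑ i, ∑ c, ∑ e,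
            Torus.Visc4.conj (G (s + τ) y) (𝔸U - 𝔸T) i c l e * (DΨ (t₀ - s - τ) c y) i * (Dw τ e y) l)) :
    ⟪U s t₀ x, φ⟫_ℝ - ⟪T s t₀ x, φ⟫_ℝ =
      (∫ τ in Ioc 0 (t₀ - s), ∑ j, ∫ y, ⟪(bU (s + τ) y) j • w τ y, DΨ (t₀ - s - τ) j y⟫_ℝ) -
        ∫ τ in Ioc 0 (t₀ - s), ∫ y, ∑ l, ∑ i, ∑ c, ∑ e,
          Torus.Visc4.conj (G (s + τ) y) (𝔸U - 𝔸T) i c l e * (DΨ (t₀ - s - τ) c y) i * (Dw τ e y) l := by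
  rw [hX, integral_sub hI1 hI2]

end Summit.AnomalousDissipation.AnomalousDissipation.Theorems.SolenoidalFractalHomogenisation.LagrangianStep.VmodDist

end
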